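import Mathlib.MeasureTheory.Constructions.HaarToSphere
import Mathlib.Analysis.InnerProductSpace.PiL2
import Mathlib.Analysis.Normed.Lp.MeasurableSpace
import Mathlib.LinearAlgebra.Complex.FiniteDimensional
import Literature.Geometry.ComplexHyperbolic.UnitBallMeasure
import Literature.Geometry.ComplexHyperbolic.UnitBallBounds
import HarnessLib

/-!
# Polar coordinates on `ℂ²` adapted to the unit ball (ROAD A (A3-b), analytic toolkit I)

The `v → u` asymptotics of the `K`-central orbital integrals of `U(2,1)` (★ `UnitBallKCentralOrbitalIntegral`,
★ `UnitBallNegativeLineProjector`: the pencil blows up like `(1 − |z|²)⁻¹` towards the boundary sphere) are read in the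
radial variable `t = 1 − |z|²`.  This module supplies the POLAR DISINTEGRATION of Lebesgue measure on `ℂ²` with respect to
the Euclidean norm `nsq z = |z₀|² + |z₁|²` (NOT the sup norm that `Fin 2 → ℂ` carries in Mathlib): transporting Mathlib's
`Measure.toSphere` ∕ `measurePreserving_homeomorphUnitSphereProd` through `EuclideanSpace ℂ (Fin 2)`,

* §1 `‖toLp 2 z‖² = nsq z`, `finrank ℝ (EuclideanSpace ℂ (Fin 2)) = 4`, `nsq (r • ω) = r² · nsq ω`;
* §2 **`exists_angularMeasure`**: there is a finite measure `σ` on `ℂ²`, carried by the unit sphere `{nsq = 1}`, of total mass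
  `4 · vol{nsq < 1}`, with `(σ ⊗ r³dr|_{(0,∞)}) ∘ ((ω, r) ↦ r•ω)⁻¹ = vol_{ℂ²}`;
* §3 consequences for any such `σ`: `∫⁻_{ℂ²} F = ∫⁻_σ ∫⁻_{r>0} r³ F(r•ω)`, the Bochner version for integrable `F`, and the BALL
  versions `∫⁻_{nsq<1} F = ∫⁻_σ ∫⁻_{0<r<1} r³ F(r•ω)` (also against ★ `ballVolume`).

References: Rudin 1980, §1.4 (integration in polar coordinates on `ℂⁿ`, 1.4.3 and 1.4.7(2)); Helgason 2000, Ch. I §1 No. 2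
(invariant integration in geodesic polar coordinates); Rogawski 1990 §8.4 (where the singular orbital integrals at the compact
wall are normalised).
HONEST LABEL: HC_CM is proved only modulo the printed citations until rung 0 closes; this file is measure-theoretic plumbing over
Mathlib's `HaarToSphere` and pays nothing by itself.
-/

noncomputable section

open MeasureTheory MeasureTheory.Measure Set Metric WithLp
open scoped ENNReal

namespace Literature.Geometry.ComplexHyperbolic.BallModel

/-! ### §1 The Euclidean model of `ℂ²` -/

/-- `‖toLp 2 z‖² = |z₀|² + |z₁|²`: the `L²` norm of `EuclideanSpace ℂ (Fin 2)` is the Hermitian norm `nsq`. [cite: Rudin1980, §1.4] -/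
theorem norm_toLp_sq (z : Fin 2 → ℂ) : ‖(toLp 2 z : EuclideanSpace ℂ (Fin 2))‖ ^ 2 = nsq z := by
  rw [EuclideanSpace.norm_sq_eq, Fin.sum_univ_two]
  rfl

/-- `nsq (ofLp x) = ‖x‖²`. [cite: Rudin1980, §1.4] -/
theorem nsq_ofLp (x : EuclideanSpace ℂ (Fin 2)) : nsq (ofLp x) = ‖x‖ ^ 2 := by
  rw [EuclideanSpace.norm_sq_eq, Fin.sum_univ_two]
  rfl

/-- `‖toLp 2 z‖ < 1 ↔ nsq z < 1`. [cite: Rudin1980, §1.4] -/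
theorem norm_toLp_lt_one_iff (z : Fin 2 → ℂ) : ‖(toLp 2 z : EuclideanSpace ℂ (Fin 2))‖ < 1 ↔ nsq z < 1 := by
  rw [← norm_toLp_sq, sq_lt_one_iff₀ (norm_nonneg _)]

/-- `dim_ℝ ℂ² = 4`. [cite: Rudin1980, §1.4] -/
theorem finrank_real_euclideanSpace_fin_two : Module.finrank ℝ (EuclideanSpace ℂ (Fin 2)) = 4 := by
  have h := Module.finrank_mul_finrank ℝ ℂ (EuclideanSpace ℂ (Fin 2))
  rw [Complex.finrank_real_complex, finrank_euclideanSpace, Fintype.card_fin] at h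
  omega

/-- `nsq (r • ω) = r² · nsq ω` for real `r`. [cite: Rudin1980, §1.4] -/
theorem nsq_real_smul (r : ℝ) (ω : Fin 2 → ℂ) : nsq (r • ω) = r ^ 2 * nsq ω := by
  simp only [nsq, Pi.smul_apply, norm_smul, Real.norm_eq_abs, mul_pow, sq_abs]
  ring

/-- The image of Lebesgue measure of `ℂ²` in the Euclidean model is an additive Haar measure. [cite: Rudin1980, §1.4] -/
theorem isAddHaarMeasure_map_toLp : ((volume : Measure (Fin 2 → ℂ)).map (toLp 2 : (Fin 2 → ℂ) → EuclideanSpace ℂ (Fin 2))).IsAddHaarMeasure := by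
  have h := ContinuousLinearEquiv.isAddHaarMeasure_map (PiLp.continuousLinearEquiv 2 ℂ (fun _ : Fin 2 => ℂ)).symm (volume : Measure (Fin 2 → ℂ))
  rwa [PiLp.coe_symm_continuousLinearEquiv] at h

/-! ### §2 The angular measure -/

/-- **POLAR COORDINATES ON `ℂ²` (Euclidean norm)**: there is a finite measure `σ` on `ℂ²` carried by the unit sphere `{nsq = 1}`, of total
mass `4 · vol{nsq < 1}`, such that `(ω, r) ↦ r • ω` pushes `σ ⊗ (r³ dr on (0, ∞))` (Mathlib's `volumeIoiPow 3`) forward to Lebesgue measure: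
`vol_{ℂ²} = ((ω, r) ↦ r•ω)_* (σ ⊗ r³dr)`.  (`σ` = the transport of `Measure.toSphere` of `EuclideanSpace ℂ (Fin 2)`.)
[cite: Rudin1980, §1.4, 1.4.3] -/
theorem exists_angularMeasure :
    ∃ σ : Measure (Fin 2 → ℂ), IsFiniteMeasure σ ∧ (∀ᵐ ω ∂σ, nsq ω = 1) ∧ σ univ = 4 * volume {w : Fin 2 → ℂ | nsq w < 1} ∧
      (σ.prod (volumeIoiPow 3)).map (fun p : (Fin 2 → ℂ) × Ioi (0 : ℝ) => (p.2 : ℝ) • p.1) = volume := by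
  haveI := isAddHaarMeasure_map_toLp
  set μ : Measure (EuclideanSpace ℂ (Fin 2)) := (volume : Measure (Fin 2 → ℂ)).map (toLp 2) with hμ
  set f : sphere (0 : EuclideanSpace ℂ (Fin 2)) 1 → (Fin 2 → ℂ) := fun ω => ofLp (ω : EuclideanSpace ℂ (Fin 2)) with hf
  have hfc : Continuous f := (PiLp.continuous_ofLp 2 (fun _ : Fin 2 => ℂ)).comp continuous_subtype_val
  have hfm : Measurable f := hfc.measurable
  refine ⟨μ.toSphere.map f, inferInstance, ?_, ?_, ?_⟩
  · -- carried by the unit sphere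
    have hS : MeasurableSet {ω : Fin 2 → ℂ | ¬ nsq ω = 1} := (isClosed_eq continuous_fun_nsq continuous_const).measurableSet.compl
    rw [ae_iff, map_apply hfm hS]
    convert measure_empty (μ := μ.toSphere)
    ext ω
    simp only [mem_preimage, mem_setOf_eq, mem_empty_iff_false, iff_false, not_not, hf, nsq_ofLp, norm_eq_of_mem_sphere ω, one_pow]
  · -- total mass
    have hpre : (toLp 2 : (Fin 2 → ℂ) → EuclideanSpace ℂ (Fin 2)) ⁻¹' ball 0 1 = {w | nsq w < 1} := by
      ext w
      simp only [mem_preimage, mem_ball, dist_zero_right, mem_setOf_eq, norm_toLp_lt_one_iff]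
    rw [map_apply hfm MeasurableSet.univ, preimage_univ, toSphere_apply_univ, finrank_real_euclideanSpace_fin_two, hμ,
      map_apply (PiLp.continuous_toLp 2 (fun _ : Fin 2 => ℂ)).measurable measurableSet_ball, hpre, Nat.cast_ofNat]
  · -- the push-forward identity
    have hs : Measurable fun p : (Fin 2 → ℂ) × Ioi (0 : ℝ) => (p.2 : ℝ) • p.1 :=
      ((continuous_subtype_val.comp continuous_snd).smul continuous_fst).measurable
    have h1 : (μ.toSphere.map f).prod (volumeIoiPow 3) = ((μ.toSphere).prod (volumeIoiPow 3)).map (Prod.map f id) := by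
      conv_lhs => rw [← Measure.map_id (μ := volumeIoiPow 3)]
      exact map_prod_map _ _ hfm measurable_id
    have h2 : (fun p : (Fin 2 → ℂ) × Ioi (0 : ℝ) => (p.2 : ℝ) • p.1) ∘ Prod.map f id =
        ((ofLp : EuclideanSpace ℂ (Fin 2) → Fin 2 → ℂ) ∘ Subtype.val) ∘ (homeomorphUnitSphereProd (EuclideanSpace ℂ (Fin 2))).toMeasurableEquiv.symm := by
      funext q
      simp only [Function.comp_apply, Prod.map_fst, Prod.map_snd, id_eq, hf, Homeomorph.toMeasurableEquiv_symm_coe,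
        homeomorphUnitSphereProd_symm_apply_coe, ofLp_smul]
    have h3 : MeasurePreserving (homeomorphUnitSphereProd (EuclideanSpace ℂ (Fin 2))).toMeasurableEquiv.symm
        ((μ.toSphere).prod (volumeIoiPow (Module.finrank ℝ (EuclideanSpace ℂ (Fin 2)) - 1))) (μ.comap Subtype.val) :=
      (μ.measurePreserving_homeomorphUnitSphereProd).symm _
    rw [finrank_real_euclideanSpace_fin_two] at h3
    have h0 : MeasurableSet ({0}ᶜ : Set (EuclideanSpace ℂ (Fin 2))) := (measurableSet_singleton 0).compl
    rw [h1, map_map hs (hfm.prodMap measurable_id), h2, ← map_map ((PiLp.continuous_ofLp 2 (fun _ : Fin 2 => ℂ)).measurable.comp measurable_subtype_coe)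
      (MeasurableEquiv.measurable _), h3.map_eq, ← map_map (PiLp.continuous_ofLp 2 (fun _ : Fin 2 => ℂ)).measurable measurable_subtype_coe,
      map_comap_subtype_coe h0, restrict_compl_singleton, hμ, map_map (PiLp.continuous_ofLp 2 (fun _ : Fin 2 => ℂ)).measurable (PiLp.continuous_toLp 2 (fun _ : Fin 2 => ℂ)).measurable]
    have hid : ((ofLp : EuclideanSpace ℂ (Fin 2) → Fin 2 → ℂ) ∘ (toLp 2 : (Fin 2 → ℂ) → EuclideanSpace ℂ (Fin 2))) = id := funext fun _ => rfl
    rw [hid, Measure.map_id]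

/-! ### §3 Integration in polar coordinates (for any angular measure `σ` as in §2) -/

/-- The radial measure `volumeIoiPow 3` is `r³ dr` on `(0, ∞)` (lower integrals). [cite: Rudin1980, §1.4] -/
theorem lintegral_volumeIoiPow_three (G : ℝ → ℝ≥0∞) :
    ∫⁻ r, G r ∂volumeIoiPow 3 = ∫⁻ r in Ioi (0 : ℝ), ENNReal.ofReal (r ^ 3) * G r := by
  have hd : Measurable fun r : Ioi (0 : ℝ) => ENNReal.ofReal ((r : ℝ) ^ 3) := by fun_prop
  have e := lintegral_subtype_comap (μ := (volume : Measure ℝ)) (measurableSet_Ioi : MeasurableSet (Ioi (0 : ℝ))) (fun r : ℝ => ENNReal.ofReal (r ^ 3) * G r)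
  rw [volumeIoiPow, lintegral_withDensity_eq_lintegral_mul_non_measurable _ hd (Filter.Eventually.of_forall fun _ => ENNReal.ofReal_lt_top), ← e]
  rfl

/-- The radial measure `volumeIoiPow 3` is `r³ dr` on `(0, ∞)` (Bochner integrals). [cite: Rudin1980, §1.4] -/
theorem integral_volumeIoiPow_three {G : Type*} [NormedAddCommGroup G] [NormedSpace ℝ G] (H : ℝ → G) :
    ∫ r, H r ∂volumeIoiPow 3 = ∫ r in Ioi (0 : ℝ), r ^ 3 • H r := by
  have hd : Measurable fun r : Ioi (0 : ℝ) => ((r : ℝ) ^ 3).toNNReal := by fun_prop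
  have e := integral_subtype_comap (μ := (volume : Measure ℝ)) (measurableSet_Ioi : MeasurableSet (Ioi (0 : ℝ))) (fun r : ℝ => r ^ 3 • H r)
  have hfun : (fun r : Ioi (0 : ℝ) => ((r : ℝ) ^ 3).toNNReal • H r) = fun r : Ioi (0 : ℝ) => (r : ℝ) ^ 3 • H r := by
    funext r
    rw [NNReal.smul_def, Real.coe_toNNReal _ (pow_nonneg r.2.out.le 3)]
  simp only [volumeIoiPow, ENNReal.ofReal]
  rw [integral_withDensity_eq_integral_smul hd, hfun, ← e]

section Consequences

variable {σ : Measure (Fin 2 → ℂ)}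

/-- **LOWER INTEGRALS IN POLAR COORDINATES**: `∫⁻_{ℂ²} F = ∫⁻_σ ∫⁻_{r>0} r³ · F(r•ω) dr dσ(ω)` for measurable `F ≥ 0`. [cite: Rudin1980, §1.4, 1.4.3] -/
theorem lintegral_eq_lintegral_polar
    (hσ : (σ.prod (volumeIoiPow 3)).map (fun p : (Fin 2 → ℂ) × Ioi (0 : ℝ) => (p.2 : ℝ) • p.1) = volume)
    (F : (Fin 2 → ℂ) → ℝ≥0∞) (hF : Measurable F) :
    ∫⁻ z, F z = ∫⁻ ω, (∫⁻ r in Ioi (0 : ℝ), ENNReal.ofReal (r ^ 3) * F (r • ω)) ∂σ := by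
  have hs : Measurable fun p : (Fin 2 → ℂ) × Ioi (0 : ℝ) => (p.2 : ℝ) • p.1 :=
    ((continuous_subtype_val.comp continuous_snd).smul continuous_fst).measurable
  rw [← hσ, lintegral_map hF hs]
  exact (lintegral_prod _ (hF.comp hs).aemeasurable).trans (lintegral_congr fun ω => lintegral_volumeIoiPow_three fun r => F (r • ω))

/-- **BOCHNER INTEGRALS IN POLAR COORDINATES**: `∫_{ℂ²} F = ∫_σ ∫_{r>0} r³ • F(r•ω) dr dσ(ω)` for integrable `F`. [cite: Rudin1980, §1.4, 1.4.3] -/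
theorem integral_eq_integral_polar {G : Type*} [NormedAddCommGroup G] [NormedSpace ℝ G] [SFinite σ]
    (hσ : (σ.prod (volumeIoiPow 3)).map (fun p : (Fin 2 → ℂ) × Ioi (0 : ℝ) => (p.2 : ℝ) • p.1) = volume)
    (F : (Fin 2 → ℂ) → G) (hF : Integrable F) :
    ∫ z, F z = ∫ ω, (∫ r in Ioi (0 : ℝ), r ^ 3 • F (r • ω)) ∂σ := by
  have hs : Measurable fun p : (Fin 2 → ℂ) × Ioi (0 : ℝ) => (p.2 : ℝ) • p.1 :=
    ((continuous_subtype_val.comp continuous_snd).smul continuous_fst).measurable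
  have hFm : AEStronglyMeasurable F (((σ.prod (volumeIoiPow 3)).map fun p : (Fin 2 → ℂ) × Ioi (0 : ℝ) => (p.2 : ℝ) • p.1)) := by
    rw [hσ]; exact hF.aestronglyMeasurable
  have hint : Integrable (F ∘ fun p : (Fin 2 → ℂ) × Ioi (0 : ℝ) => (p.2 : ℝ) • p.1) (σ.prod (volumeIoiPow 3)) := by
    refine (integrable_map_measure hFm hs.aemeasurable).1 ?_
    rw [hσ]; exact hF
  conv_lhs => rw [← hσ]
  rw [integral_map hs.aemeasurable hFm]
  exact (integral_prod _ hint).trans (integral_congr_ae (Filter.Eventually.of_forall fun ω => integral_volumeIoiPow_three fun r => F (r • ω)))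

/-- **THE BALL IN POLAR COORDINATES** (lower integrals): `∫⁻_{nsq<1} F = ∫⁻_σ ∫⁻_{0<r<1} r³ · F(r•ω) dr dσ(ω)`, for `σ` carried by the unit sphere.
[cite: Rudin1980, §1.4, 1.4.3] -/
theorem setLIntegral_nsq_lt_one_eq_lintegral_polar
    (hσ : (σ.prod (volumeIoiPow 3)).map (fun p : (Fin 2 → ℂ) × Ioi (0 : ℝ) => (p.2 : ℝ) • p.1) = volume)
    (hσ1 : ∀ᵐ ω ∂σ, nsq ω = 1) (F : (Fin 2 → ℂ) → ℝ≥0∞) (hF : Measurable F) :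
    ∫⁻ z in {w | nsq w < 1}, F z = ∫⁻ ω, (∫⁻ r in Ioo (0 : ℝ) 1, ENNReal.ofReal (r ^ 3) * F (r • ω)) ∂σ := by
  have hB : MeasurableSet {w : Fin 2 → ℂ | nsq w < 1} := measurableSet_setOf_nsq_lt
  rw [← lintegral_indicator hB, lintegral_eq_lintegral_polar hσ _ (hF.indicator hB)]
  refine lintegral_congr_ae (hσ1.mono fun ω hω => ?_)
  dsimp only
  rw [← lintegral_indicator measurableSet_Ioi, ← lintegral_indicator measurableSet_Ioo]
  refine lintegral_congr fun r => ?_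
  by_cases hr : 0 < r
  · have hmem : (r • ω ∈ {w : Fin 2 → ℂ | nsq w < 1}) ↔ r < 1 := by
      rw [mem_setOf_eq, nsq_real_smul, hω, mul_one, sq_lt_one_iff₀ hr.le]
    by_cases hr1 : r < 1
    · rw [indicator_of_mem (mem_Ioi.2 hr), indicator_of_mem (mem_Ioo.2 ⟨hr, hr1⟩), indicator_of_mem (hmem.2 hr1)]
    · rw [indicator_of_mem (mem_Ioi.2 hr), indicator_of_notMem (fun h => hr1 (mem_Ioo.1 h).2), indicator_of_notMem (fun h => hr1 (hmem.1 h)),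
        mul_zero]
  · rw [indicator_of_notMem (fun h => hr (mem_Ioi.1 h)), indicator_of_notMem (fun h => hr (mem_Ioo.1 h).1)]

/-- **THE BALL IN POLAR COORDINATES** (Bochner): `∫_{nsq<1} F = ∫_σ ∫_{0<r<1} r³ • F(r•ω) dr dσ(ω)` for `F` integrable on the ball.
[cite: Rudin1980, §1.4, 1.4.3] -/
theorem setIntegral_nsq_lt_one_eq_integral_polar {G : Type*} [NormedAddCommGroup G] [NormedSpace ℝ G] [SFinite σ]
    (hσ : (σ.prod (volumeIoiPow 3)).map (fun p : (Fin 2 → ℂ) × Ioi (0 : ℝ) => (p.2 : ℝ) • p.1) = volume)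
    (hσ1 : ∀ᵐ ω ∂σ, nsq ω = 1) (F : (Fin 2 → ℂ) → G) (hF : IntegrableOn F {w | nsq w < 1}) :
    ∫ z in {w | nsq w < 1}, F z = ∫ ω, (∫ r in Ioo (0 : ℝ) 1, r ^ 3 • F (r • ω)) ∂σ := by
  have hB : MeasurableSet {w : Fin 2 → ℂ | nsq w < 1} := measurableSet_setOf_nsq_lt
  rw [← integral_indicator hB, integral_eq_integral_polar hσ _ (hF.integrable_indicator hB)]
  refine integral_congr_ae (hσ1.mono fun ω hω => ?_)
  dsimp only
  rw [← integral_indicator measurableSet_Ioi, ← integral_indicator measurableSet_Ioo]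
  refine integral_congr_ae (Filter.Eventually.of_forall fun r => ?_)
  by_cases hr : 0 < r
  · have hmem : (r • ω ∈ {w : Fin 2 → ℂ | nsq w < 1}) ↔ r < 1 := by
      rw [mem_setOf_eq, nsq_real_smul, hω, mul_one, sq_lt_one_iff₀ hr.le]
    by_cases hr1 : r < 1
    · simp only [indicator_of_mem (mem_Ioi.2 hr), indicator_of_mem (mem_Ioo.2 ⟨hr, hr1⟩), indicator_of_mem (hmem.2 hr1)]
    · simp only [indicator_of_mem (mem_Ioi.2 hr), indicator_of_notMem (fun h => hr1 (mem_Ioo.1 h).2),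
        indicator_of_notMem (fun h => hr1 (hmem.1 h)), smul_zero]
  · simp only [indicator_of_notMem (fun h => hr (mem_Ioi.1 h)), indicator_of_notMem (fun h => hr (mem_Ioo.1 h).1)]

/-- The same against ★ `ballVolume` (Lebesgue measure ON the ball `𝔹²` as a type): `∫⁻_{𝔹²} f(z) = ∫⁻_σ ∫⁻_{0<r<1} r³ f(r•ω)` for `f` read through an
ambient measurable `F` (`f z = F z.1`). [cite: Rudin1980, §1.4, 1.4.3] -/
theorem lintegral_ballVolume_eq_lintegral_polar
    (hσ : (σ.prod (volumeIoiPow 3)).map (fun p : (Fin 2 → ℂ) × Ioi (0 : ℝ) => (p.2 : ℝ) • p.1) = volume)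
    (hσ1 : ∀ᵐ ω ∂σ, nsq ω = 1) (F : (Fin 2 → ℂ) → ℝ≥0∞) (hF : Measurable F) :
    ∫⁻ z, F z.1 ∂ballVolume = ∫⁻ ω, (∫⁻ r in Ioo (0 : ℝ) 1, ENNReal.ofReal (r ^ 3) * F (r • ω)) ∂σ := by
  rw [lintegral_ballVolume, setLIntegral_nsq_lt_one_eq_lintegral_polar hσ hσ1 F hF]

/-- … and for Bochner integrals against ★ `ballVolume`. [cite: Rudin1980, §1.4, 1.4.3] -/
theorem integral_ballVolume_eq_integral_polar {G : Type*} [NormedAddCommGroup G] [NormedSpace ℝ G] [SFinite σ]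
    (hσ : (σ.prod (volumeIoiPow 3)).map (fun p : (Fin 2 → ℂ) × Ioi (0 : ℝ) => (p.2 : ℝ) • p.1) = volume)
    (hσ1 : ∀ᵐ ω ∂σ, nsq ω = 1) (F : (Fin 2 → ℂ) → G) (hF : IntegrableOn F {w | nsq w < 1}) :
    ∫ z, F z.1 ∂ballVolume = ∫ ω, (∫ r in Ioo (0 : ℝ) 1, r ^ 3 • F (r • ω)) ∂σ := by
  rw [integral_ballVolume, setIntegral_nsq_lt_one_eq_integral_polar hσ hσ1 F hF]

end Consequences

end Literature.Geometry.ComplexHyperbolic.BallModel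

end
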